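import Literature.Computability.AlgebraicComplexity.BasicTensorSubspaces
import Literature.Computability.AlgebraicComplexity.FlatteningBound
import Mathlib.Analysis.SpecialFunctions.Pow.Asymptotics
import Mathlib.Analysis.SpecialFunctions.Log.Base
import Mathlib.Analysis.Complex.Basic
import Mathlib.Data.Sym.Card
import HarnessLib

/-!
# Graph tensors `T_n(G)`, their exponent `ω(T(G))` and exponent per edge `τ(T(G))`
# (Christandl–Vrana–Zuiddam 2019, §1.1–§1.2; Brand et al. 2026, §3, App. C)

Topic `Literature/Computability/AlgebraicComplexity`, after `RankMethodBarriers.lean` (`rankOneTensor`,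
`tensorRankD` — rank of a `k`-tensor in the cubic format `(Fin k → Fin N) → F`),
`BasicTensorSubspaces.lean` (`rankOneTensor_single`) and `MatrixMultiplicationExponent.lean` /
`FlatteningBound.lean` (`admissibleExponents`, `omega`, `omega_two_le`).  Definition item
`defn-GraphTensor` (route `route-MatrixMultiplication-TetrahedronCarving`, crux `TetraFlat`).

## What is printed

* [CVZ19] M. Christandl, P. Vrana, J. Zuiddam, *Asymptotic tensor rank of graph tensors: beyond
  matrix multiplication*, comput. complexity 28 (2019) 57–111, arXiv:1609.07476.
  Def. 1.1.1 (p. 4): "Let `G = (V,E)` be a graph and let `n` be a natural number. Let `b_1,…,b_n` be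
  the standard basis of `ℂ^n`. We define the `|V|`-tensor `T_n(G)` as
  `T_n(G) := ∑_{i ∈ [n]^E} ⊗_{v ∈ V} ( ⊗_{e ∈ E : v ∈ e} b_{i_e} )`, where the sum is over all tuples
  `i` indexed by `E` with entries in `[n]`. … The definition naturally generalizes to hypergraphs."
  "We can ignore the fact that the tensor in the above definition depends on the choice of order of
  the edges and vertices of the graph `G`, since tensor rank and subrank do not depend on this
  order."  Ex. 1.1.2: `T_n(K_4) = ∑_{i∈[n]^6} b_{i₁i₂i₅} ⊗ b_{i₂i₃i₆} ⊗ b_{i₃i₄i₅} ⊗ b_{i₁i₄i₆}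
  ∈ (ℂ^{n³})^{⊗4}`; "`T_n(C_3)` is … the `n × n` matrix multiplication tensor … `⟨n,n,n⟩`. For
  `k ≥ 3`, `T_n(C_k)` is the iterated matrix multiplication tensor".
  Def. 1.1.13: `ω(ψ) := ω(T, ψ)` (asymptotic conversion rate from the unit tensor);
  Prop. 1.1.18: "Let `G` be a graph. Then `ω(T(G)) = inf {β ∈ ℝ | R(T_n(G)) = O(n^β)}`."
  Def. 1.1.22: "`ω := ω(T(C_3))` … the exponent of matrix multiplication."
  Thm. 1.1.24 (Christandl–Zuiddam): "Let `k ∈ ℕ_{≥1}`. Then `ω(T(C_k)) = k` when `k` is even,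
  `k − 1 ≤ ω(T(C_k)) ≤ (k−1)/2 · ω` when `k` is odd. … In particular, if `ω = 2` … then
  `ω(T(C_k)) = k − 1` when `k` is odd."  (A third clause in terms of the dual exponent `α` is not
  vendored here.)
  Def. 1.1.25: "For any graph `G = (V,E)`, we define the exponent per edge
  `τ(T(G)) := ω(T(G))/|E|`."
  Prop. 1.1.26: "Let `k ≥ ℓ ≥ 2` be integers. Then `τ(T(K_k)) ≤ τ(T(K_ℓ))`."
  §1.2, Problem 1.2.1: "For `k ≥ 4`, what is the value of `τ(T(K_k))`?"; eq. (1.4): flattening along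
  a max-cut gives `τ(T(K_k)) ≥ f(K_k)/binom(k,2)`, `f(K_k) = k²/4` (`k` even), `(k−1)(k+1)/4` (`k` odd);
  "`τ(T(K_3)) = ω/3` and thus … `τ(T(K_k)) ≤ ω/3` for all `k ≥ 3`";
  Cor. 1.2.6: "For `k ≥ 4`, `τ(T(K_k)) ≤ min_{q ≥ 2} log_q((q+2)/2) = log_7(9/2)` which is
  approximately `0.772943`."  (Thm. 1.2.2, the bound through the monomial subexponent of the Dicke
  tensor `D_{(2,k−2)}`, needs vocabulary the tree lacks and is not vendored.)
* [BCKLOSW26] C. Brand, R. Curticapean, P. Kaski, B. Li, I. Orzel, T. Seppelt, J. Wang, *Beyond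
  bilinear complexity: what works and what breaks with many modes?*, arXiv:2602.11975 (2026).
  Def. 9 (p. 13): `T_{G,n} = ∑_{f : E(G) → [n]} ∏_{v ∈ V} x^{(v)}_{f|I(v)}` (the same object, as a
  set-multilinear polynomial); §3.2 (p. 15): "`ω(G) := inf{β | R(T_{G,n}) = O(n^β)}`. …
  `τ(G) := ω(G)/|E(G)|`"; §3.2 (p. 16): "`τ(d) := τ(K_d)`"; Remark 21 (p. 17): "`τ(d) ≤ τ(4)` for
  `d ≥ 4`. … `ω = 2` would imply `τ(3) = τ(4) = 2/3`. It is an open problem whether there is a `d`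
  such that `τ(d) < 2/3`. … `τ(d) ≥ 1/2` … for all `d ≥ 4`"; Thm. 48 (App. C, p. 51): "For the
  `4`-clique, we have `τ(K_4) < 0.772318`."  (Lemma 20, `R̃(T) ≤ n^{(d−1)τ(d)}` for every `d`-mode
  tensor, is a statement about ASYMPTOTIC rank of a single tensor and is not vendored here: the tree
  has no Kronecker powers in the cubic `tensorRankD` format yet.)

## How it is rendered here

A (hyper)graph on the vertex set `Fin k` with edge set a finite type `E` is presented by its
INCIDENCE SLOTS `σ : Fin k → Fin D → E`: vertex `v` reads, in slot `j`, the label of the edge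
`σ v j`; the hyperedge `e` is `{v | e ∈ range (σ v)}`; every vertex has the same number `D` of slots
(the tree's rank `tensorRankD` lives on the cubic format, all legs of the same dimension `n^D`).
Regular graphs — the printed families `K_k` (`D = k−1`), `C_k` (`D = 2`) and the unit-tensor
hypergraph — are presented with each incident edge read exactly once; reading an incident edge twice
embeds the leg `F^{n^{deg v}}` into `F^{n^D}` along a coordinate diagonal and does not change rank,
so non-regular graphs without isolated vertices are covered too (not used below).  With labels
`l : E → Fin n` the summand of Def. 1.1.1 is the rank-one tensor `⊗_v b_{(l (σ v j))_j}`
(`graphLeg`), the inner `⊗_{e ∋ v} b_{i_e}` being the basis vector of `F^{n^D}` indexed by the slot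
tuple through `finFunctionFinEquiv : (Fin D → Fin n) ≃ Fin (n^D)` — the format of the tree's
tetrahedron tensor `Summit.MatrixMultiplication.….TetrahedronTensor.tetra` (whose slot table is
`tetraSlots` below: `tetra F n = graphTensor F tetraSlots n` is `tetra_eq_sum` plus
`vertexLabels e v = fun j => e (tetraSlots v j)`, a `fin_cases` check left to the Summit side, which
Literature may not import).  Everything is over an arbitrary field `F`; the NAMED FACTS are stated at
`F = ℂ`, where they are printed.

* `graphTensor F σ n : (Fin k → Fin (n ^ D)) → F` — CVZ19 Def. 1.1.1 / BCKLOSW26 Def. 9;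
  `graphTensor_apply` (entry = number of labellings with the given slot tuples),
  `graphTensor_apply_of_covering` (`{0,1}` entries under COVERING: `∀ e, ∃ v j, σ v j = e`, no
  empty edge), `tensorRankD_graphTensor_le : R(T_n(G)) ≤ n^{|E|}` (the trivial cover), relabelling
  invariance `graphTensor_relabel` (CVZ19: "does not depend on the order of the edges").
* `graphExponents F σ = {β | R(T_n(G)) = O(n^β)}`, `graphOmega F σ = sInf …` (`ω(T(G))`, CVZ19
  Prop. 1.1.18 / BCKLOSW26 §3.2), `graphTau F σ = ω(T(G))/|E|` (Def. 1.1.25); API: non-empty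
  (`|E|` is admissible), upward closed, bounded below by `0` under covering, `graphOmega_le_card`,
  `graphOmega_nonneg`, `mem_graphExponents_of_lt`.
* Instances: `cliqueSlots d` (`K_{d+1}`, edges `{e : Sym2 (Fin (d+1)) // ¬ e.IsDiag}`, slot `j` of
  `v` = the edge to `v.succAbove j`), `cycleSlots k` (`C_k`, edges `Fin k`, edge `e = {e, e+1}`),
  `tetraSlots` (`K_4` in the edge order `01,02,03,12,13,23` of the tree's `tetra`);
  `graphTensor_cliqueSlots_three` (`K_4` through `cliqueSlots` IS the tetrahedron tensor of
  `tetraSlots`, by relabelling), hence `graphOmega`/`graphTau` agree (`graphTau_cliqueSlots_three`).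
* NAMED FACTS (`def … : Prop`, users take `(h : …)`; four, exactly the requested printed results
  that are not re-provable from the tree today): `cvz19_thm_1_1_24` (cycles), `cvz19_prop_1_1_26`
  (clique monotonicity of `τ`), `cvz19_cor_1_2_6` (`τ(T(K_k)) ≤ log_7 (9/2)`, `k ≥ 4`),
  `brandEtAl2026_thm_48` (`τ(K_4) < 0.772318`); corollaries at `K_4` in terms of `ω(T(K_4))`
  (`…graphOmega_tetraSlots_le`, `…_lt`: the printed ladder `6 → 4.63766 → 4.633908`).
  NOT vendored as facts: the max-cut flattening bound eq. (1.4) and Remark 21's `τ(d) ≥ 1/2`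
  (provable flattenings — the tree has the `K_4` case `four_le_omegaTetra`), the triangle cover
  `τ(T(K_k)) ≤ ω/3` (= Prop. 1.1.26 + `T_n(K_3) ≅ ⟨n,n,n⟩`; the tree has `omegaTetra_le_two_mul_omega`),
  CVZ19 Question 1.3.2 / BCKLOSW26 Remark 21 "is there a `d` with `τ(d) < 2/3`?" (OPEN PROBLEMS).

No `sorry`, no axiom, no instance, no notation.

## References

* [CVZ19] Christandl–Vrana–Zuiddam, arXiv:1609.07476, Def. 1.1.1, Ex. 1.1.2, Def. 1.1.13,
  Prop. 1.1.18, Def. 1.1.22, Thm. 1.1.24, Def. 1.1.25, Prop. 1.1.26, §1.2 (Problem 1.2.1, eq. (1.4),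
  Cor. 1.2.6, table).  [ChristandlVranaZuiddam2016]
* [BCKLOSW26] Brand–Curticapean–Kaski–Li–Orzel–Seppelt–Wang, arXiv:2602.11975, Def. 9 (p. 13),
  §3.2 (pp. 15–17: `ω(G)`, `τ(G)`, `τ(d)`, Lemma 20, Thm. 1, Remark 21), Thm. 48 (p. 51).
  [BrandEtAl2026]
-/

noncomputable section

open scoped BigOperators
open Filter Asymptotics

namespace Literature.Computability.AlgebraicComplexity

/-! ## §1. The graph tensor of an incidence presentation (CVZ19 Def. 1.1.1) -/

section GraphTensor

variable (F : Type*) [Field F] {k D : ℕ} {E : Type*} [Fintype E] [DecidableEq E]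

/-- The leg index at vertex `v` of the summand labelled `l : E → Fin n`: the slot tuple
`(l (σ v 0), …, l (σ v (D-1)))` encoded in `Fin (n^D)` by `finFunctionFinEquiv` (CVZ19 Def. 1.1.1:
the inner tensor `⊗_{e ∋ v} b_{i_e}`). [cite: ChristandlVranaZuiddam2016, Def. 1.1.1] -/
def slotIndex (σ : Fin k → Fin D → E) {n : ℕ} (l : E → Fin n) (v : Fin k) : Fin (n ^ D) :=
  finFunctionFinEquiv fun j => l (σ v j)

/-- The `k` legs `v ↦ b_{slotIndex σ l v}` of the summand of `T_n(G)` labelled `l`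
(CVZ19 Def. 1.1.1). [cite: ChristandlVranaZuiddam2016, Def. 1.1.1] -/
def graphLeg (σ : Fin k → Fin D → E) {n : ℕ} (l : E → Fin n) : Fin k → Fin (n ^ D) → F :=
  fun v => Pi.single (slotIndex σ l v) 1

/-- **The graph tensor** `T_n(G) = ∑_{l ∈ [n]^E} ⊗_{v} b_{(l(σ v j))_j} ∈ (F^{n^D})^{⊗k}` of the
(hyper)graph on `Fin k` presented by its incidence slots `σ : Fin k → Fin D → E` (vertex `v` reads
in slot `j` the label of the edge `σ v j`), at level `n`, in the cubic format of `tensorRankD`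
(CVZ19 Def. 1.1.1; BCKLOSW26 Def. 9). [cite: ChristandlVranaZuiddam2016, Def. 1.1.1] -/
def graphTensor (σ : Fin k → Fin D → E) (n : ℕ) : (Fin k → Fin (n ^ D)) → F :=
  ∑ l : E → Fin n, rankOneTensor (graphLeg F σ l)

variable {F}

omit [Fintype E] [DecidableEq E] in
/-- The summand labelled `l` is the elementary tensor at the multi-index `slotIndex σ l`.
[cite: ChristandlVranaZuiddam2016, Def. 1.1.1] -/
theorem rankOneTensor_graphLeg (σ : Fin k → Fin D → E) {n : ℕ} (l : E → Fin n) :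
    rankOneTensor (graphLeg F σ l) = Pi.single (slotIndex σ l) 1 :=
  rankOneTensor_single (slotIndex σ l)

/-- `T_n(G)` as a sum of elementary tensors. [cite: ChristandlVranaZuiddam2016, Def. 1.1.1] -/
theorem graphTensor_eq_sum_single (σ : Fin k → Fin D → E) (n : ℕ) :
    graphTensor F σ n = ∑ l : E → Fin n, Pi.single (slotIndex σ l) (1 : F) := by
  unfold graphTensor
  exact Finset.sum_congr rfl fun l _ => rankOneTensor_graphLeg σ l

/-- Entries of `T_n(G)`: the entry at the multi-index `i` is the NUMBER of labellings `l` whose slot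
tuples are `i` (for a graph with no empty edge this is `0` or `1`, `graphTensor_apply_of_covering`).
[cite: ChristandlVranaZuiddam2016, Def. 1.1.1] -/
theorem graphTensor_apply (σ : Fin k → Fin D → E) (n : ℕ) (i : Fin k → Fin (n ^ D)) :
    graphTensor F σ n i = ((Finset.univ.filter fun l : E → Fin n => slotIndex σ l = i).card : F) := by
  classical
  rw [graphTensor_eq_sum_single, Finset.sum_apply]
  simp only [Pi.single_apply]
  rw [Finset.sum_ite, Finset.sum_const_zero, add_zero, Finset.sum_const, nsmul_eq_mul, mul_one]
  congr 2
  exact Finset.filter_congr fun l _ => eq_comm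

omit [Fintype E] [DecidableEq E] in
/-- If every edge is read by some vertex (no empty edge), the labelling is determined by its slot
tuples: `l ↦ slotIndex σ l` is injective. [cite: ChristandlVranaZuiddam2016, Def. 1.1.1] -/
theorem slotIndex_injective {σ : Fin k → Fin D → E} (hσ : ∀ e, ∃ v j, σ v j = e) (n : ℕ) :
    Function.Injective (fun l : E → Fin n => slotIndex σ l) := by
  intro l l' h
  funext e
  obtain ⟨v, j, rfl⟩ := hσ e
  have hv : slotIndex σ l v = slotIndex σ l' v := congrFun h v
  simp only [slotIndex, Equiv.apply_eq_iff_eq] at hv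
  exact congrFun hv j

/-- For a graph with no empty edge the entries of `T_n(G)` are `0` or `1`: `1` exactly at the slot
tuples of a labelling (CVZ19 Def. 1.1.1 / Ex. 1.1.2). [cite: ChristandlVranaZuiddam2016, Ex. 1.1.2] -/
theorem graphTensor_apply_of_covering {σ : Fin k → Fin D → E} (hσ : ∀ e, ∃ v j, σ v j = e) (n : ℕ)
    (i : Fin k → Fin (n ^ D)) [Decidable (∃ l : E → Fin n, slotIndex σ l = i)] :
    graphTensor F σ n i = if ∃ l : E → Fin n, slotIndex σ l = i then 1 else 0 := by
  classical
  rw [graphTensor_apply]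
  split_ifs with h
  · obtain ⟨l, hl⟩ := h
    have : (Finset.univ.filter fun l' : E → Fin n => slotIndex σ l' = i) = {l} := by
      ext l'
      simp only [Finset.mem_filter, Finset.mem_univ, true_and, Finset.mem_singleton]
      constructor
      · intro hl'
        exact slotIndex_injective hσ n (hl'.trans hl.symm)
      · rintro rfl
        exact hl
    rw [this, Finset.card_singleton, Nat.cast_one]
  · have : (Finset.univ.filter fun l' : E → Fin n => slotIndex σ l' = i) = ∅ := by
      ext l'
      simp only [Finset.mem_filter, Finset.mem_univ, true_and, Finset.notMem_empty, iff_false]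
      exact fun hl' => h ⟨l', hl'⟩
    rw [this, Finset.card_empty, Nat.cast_zero]

/-- The entry of `T_n(G)` at the slot tuples of a labelling is `1` (no empty edge). [cite: ChristandlVranaZuiddam2016, Ex. 1.1.2] -/
theorem graphTensor_apply_slotIndex {σ : Fin k → Fin D → E} (hσ : ∀ e, ∃ v j, σ v j = e) {n : ℕ}
    (l : E → Fin n) : graphTensor F σ n (slotIndex σ l) = 1 := by
  classical
  rw [graphTensor_apply_of_covering hσ, if_pos ⟨l, rfl⟩]

/-- `T_n(G)` decomposes over rank-one tensors (so `tensorRankD` is an attained minimum).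
[cite: ChristandlVranaZuiddam2016, Def. 1.1.1] -/
theorem graphTensor_decomposable (σ : Fin k → Fin D → E) (n : ℕ) :
    ∃ s : ℕ, ∃ g : Fin s → ((Fin k → Fin (n ^ D)) → F),
      (∀ t, g t ∈ rankOneTensors F (n ^ D) k) ∧ ∑ t, g t = graphTensor F σ n := by
  classical
  let e := Fintype.equivFin (E → Fin n)
  refine ⟨Fintype.card (E → Fin n), fun t => rankOneTensor (graphLeg F σ (e.symm t)),
    fun t => rankOneTensor_mem _, ?_⟩
  unfold graphTensor
  exact Fintype.sum_equiv e.symm _ _ (fun _ => rfl)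

/-- **The trivial cover** `R(T_n(G)) ≤ n^{|E|}`: one rank-one tensor per labelling (CVZ19 §1.2,
table, "the trivial upper bound on `ω(T(K_k))` given by the number of edges").
[cite: ChristandlVranaZuiddam2016, §1.2 (table)] -/
theorem tensorRankD_graphTensor_le (σ : Fin k → Fin D → E) (n : ℕ) :
    tensorRankD (graphTensor F σ n) ≤ n ^ Fintype.card E := by
  classical
  have hcard : Fintype.card (E → Fin n) = n ^ Fintype.card E := by
    rw [Fintype.card_fun, Fintype.card_fin]
  let e : (E → Fin n) ≃ Fin (n ^ Fintype.card E) := Fintype.equivFinOfCardEq hcard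
  refine tensorRankD_le_of_eq_sum (fun t => graphLeg F σ (e.symm t)) ?_
  unfold graphTensor
  exact Fintype.sum_equiv e.symm _ _ (fun _ => rfl)

/-- A tensor of rank `0` that decomposes over rank-one tensors is `0` (`c_S(f) = 0` only for the empty
sum, EGOW 2018 §1.1). [cite: EfremenkoGargOliveiraWigderson2018, §1.1] -/
theorem eq_zero_of_tensorRankD_eq_zero {d N : ℕ} {T : (Fin d → Fin N) → F}
    (hT : ∃ s : ℕ, ∃ g : Fin s → ((Fin d → Fin N) → F),
      (∀ t, g t ∈ rankOneTensors F N d) ∧ ∑ t, g t = T)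
    (h0 : tensorRankD T = 0) : T = 0 := by
  obtain ⟨g, -, hg⟩ := sComplexity_spec hT
  rw [← hg]
  have : ∀ (s : ℕ) (g' : Fin s → ((Fin d → Fin N) → F)), s = 0 → ∑ t, g' t = 0 := by
    rintro s g' rfl
    simp
  exact this _ g h0

/-- For `n ≥ 1` and a graph with no empty edge, `T_n(G) ≠ 0` (its entry at the slot tuples of the
constant labelling is `1`). [cite: ChristandlVranaZuiddam2016, Ex. 1.1.2] -/
theorem graphTensor_ne_zero {σ : Fin k → Fin D → E} (hσ : ∀ e, ∃ v j, σ v j = e) {n : ℕ}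
    (hn : 1 ≤ n) : graphTensor F σ n ≠ 0 := by
  intro h
  have h1 := graphTensor_apply_slotIndex (F := F) hσ (fun _ : E => (⟨0, hn⟩ : Fin n))
  rw [h] at h1
  exact zero_ne_one h1

/-- For `n ≥ 1` and a graph with no empty edge, `1 ≤ R(T_n(G))`. [cite: ChristandlVranaZuiddam2016, Ex. 1.1.2] -/
theorem one_le_tensorRankD_graphTensor {σ : Fin k → Fin D → E} (hσ : ∀ e, ∃ v j, σ v j = e)
    {n : ℕ} (hn : 1 ≤ n) : 1 ≤ tensorRankD (graphTensor F σ n) := by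
  by_contra h
  rw [not_le, Nat.lt_one_iff] at h
  exact graphTensor_ne_zero hσ hn (eq_zero_of_tensorRankD_eq_zero (graphTensor_decomposable σ n) h)

/-- **Independence of the edge names** (CVZ19, after Def. 1.1.1: "the tensor … depends on the choice
of order of the edges … tensor rank … do[es] not depend on this order"): relabelling the edge set
along a bijection does not change `T_n(G)` at all. [cite: ChristandlVranaZuiddam2016, Def. 1.1.1] -/
theorem graphTensor_relabel {E' : Type*} [Fintype E'] [DecidableEq E'] (π : E ≃ E')
    (σ : Fin k → Fin D → E) (n : ℕ) :
    graphTensor F (fun v j => π (σ v j)) n = graphTensor F σ n := by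
  unfold graphTensor
  exact Fintype.sum_equiv (π.arrowCongr (Equiv.refl (Fin n))).symm _ _ (fun l' => rfl)

end GraphTensor

/-! ## §2. The exponent `ω(T(G))` and the exponent per edge `τ(T(G))`
(CVZ19 Def. 1.1.13 / Prop. 1.1.18, Def. 1.1.25; BCKLOSW26 §3.2) -/

section Exponent

variable (F : Type*) [Field F] {k D : ℕ} {E : Type*} [Fintype E] [DecidableEq E]

/-- The admissible exponents `{β ∈ ℝ | R(T_n(G)) = O(n^β)}` of the graph tensor family (CVZ19
Prop. 1.1.18; the tree's `admissibleExponents` is the case `G = K_3` up to format).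
[cite: ChristandlVranaZuiddam2016, Prop. 1.1.18] -/
def graphExponents (σ : Fin k → Fin D → E) : Set ℝ :=
  {β : ℝ | (fun n : ℕ => (tensorRankD (graphTensor F σ n) : ℝ)) =O[atTop] fun n : ℕ => (n : ℝ) ^ β}

/-- **The exponent of a graph tensor** `ω(T(G)) = inf {β | R(T_n(G)) = O(n^β)}` (CVZ19 Def. 1.1.13
with Prop. 1.1.18; BCKLOSW26 §3.2 "`ω(G)`"). [cite: ChristandlVranaZuiddam2016, Prop. 1.1.18] -/
def graphOmega (σ : Fin k → Fin D → E) : ℝ :=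
  sInf (graphExponents F σ)

/-- **The exponent per edge** `τ(T(G)) = ω(T(G))/|E|` (CVZ19 Def. 1.1.25; BCKLOSW26 §3.2 "`τ(G)`").
[cite: ChristandlVranaZuiddam2016, Def. 1.1.25] -/
def graphTau (σ : Fin k → Fin D → E) : ℝ :=
  graphOmega F σ / Fintype.card E

variable {F}

/-- Unfolding lemma. [cite: ChristandlVranaZuiddam2016, Prop. 1.1.18] -/
theorem mem_graphExponents_iff (σ : Fin k → Fin D → E) (β : ℝ) :
    β ∈ graphExponents F σ ↔
      (fun n : ℕ => (tensorRankD (graphTensor F σ n) : ℝ)) =O[atTop] fun n : ℕ => (n : ℝ) ^ β :=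
  Iff.rfl

/-- `|E|` is an admissible exponent (the trivial cover `R(T_n(G)) ≤ n^{|E|}`).
[cite: ChristandlVranaZuiddam2016, §1.2 (table)] -/
theorem card_mem_graphExponents (σ : Fin k → Fin D → E) :
    (Fintype.card E : ℝ) ∈ graphExponents F σ := by
  refine IsBigO.of_bound 1 (Eventually.of_forall fun n => ?_)
  rw [one_mul, Real.norm_of_nonneg (Nat.cast_nonneg _),
    Real.norm_of_nonneg (Real.rpow_nonneg (Nat.cast_nonneg _) _), Real.rpow_natCast]
  exact_mod_cast tensorRankD_graphTensor_le (F := F) σ n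

/-- The admissible exponents are non-empty. [cite: ChristandlVranaZuiddam2016, §1.2 (table)] -/
theorem graphExponents_nonempty (σ : Fin k → Fin D → E) : (graphExponents F σ).Nonempty :=
  ⟨_, card_mem_graphExponents σ⟩

/-- Admissible exponents are upward closed. [cite: ChristandlVranaZuiddam2016, Prop. 1.1.18] -/
theorem mem_graphExponents_of_le {σ : Fin k → Fin D → E} {β γ : ℝ} (hβ : β ∈ graphExponents F σ)
    (h : β ≤ γ) : γ ∈ graphExponents F σ := by
  refine hβ.trans ?_
  refine IsBigO.of_bound 1 ?_
  filter_upwards [eventually_ge_atTop 1] with n hn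
  have hn' : (1 : ℝ) ≤ n := by exact_mod_cast hn
  rw [one_mul, Real.norm_of_nonneg (Real.rpow_nonneg (by positivity) _),
    Real.norm_of_nonneg (Real.rpow_nonneg (by positivity) _)]
  exact Real.rpow_le_rpow_of_exponent_le hn' h

/-- For a graph with no empty edge every admissible exponent is `≥ 0` (`R(T_n(G)) ≥ 1`).
[cite: ChristandlVranaZuiddam2016, Prop. 1.1.18] -/
theorem nonneg_of_mem_graphExponents {σ : Fin k → Fin D → E} (hσ : ∀ e, ∃ v j, σ v j = e) {β : ℝ}
    (hβ : β ∈ graphExponents F σ) : 0 ≤ β := by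
  by_contra hlt
  rw [not_le] at hlt
  obtain ⟨C, hC⟩ := isBigO_iff.1 hβ
  have hev : ∀ᶠ n : ℕ in atTop, (1 : ℝ) ≤ C * (n : ℝ) ^ β := by
    filter_upwards [hC, eventually_ge_atTop 1] with n hn hn1
    rw [Real.norm_of_nonneg (Nat.cast_nonneg _),
      Real.norm_of_nonneg (Real.rpow_nonneg (Nat.cast_nonneg _) _)] at hn
    refine le_trans ?_ hn
    exact_mod_cast one_le_tensorRankD_graphTensor (F := F) hσ hn1
  have hlim : Tendsto (fun n : ℕ => C * (n : ℝ) ^ β) atTop (nhds (C * 0)) :=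
    ((tendsto_rpow_neg_atTop (by linarith : 0 < -β)).comp tendsto_natCast_atTop_atTop
      |>.congr (fun n => by simp)).const_mul C
  rw [mul_zero] at hlim
  obtain ⟨n, hn₁, hn₂⟩ := (hev.and (hlim.eventually (gt_mem_nhds (by norm_num : (0:ℝ) < 1)))).exists
  exact absurd hn₁ (not_le.2 hn₂)

/-- For a graph with no empty edge the admissible exponents are bounded below (by `0`).
[cite: ChristandlVranaZuiddam2016, Prop. 1.1.18] -/
theorem graphExponents_bddBelow {σ : Fin k → Fin D → E} (hσ : ∀ e, ∃ v j, σ v j = e) :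
    BddBelow (graphExponents F σ) :=
  ⟨0, fun _ hβ => nonneg_of_mem_graphExponents hσ hβ⟩

/-- **`ω(T(G)) ≤ |E|`**, i.e. `τ(T(G)) ≤ 1` (trivial cover; CVZ19 §1.2 table, last column).
[cite: ChristandlVranaZuiddam2016, §1.2 (table)] -/
theorem graphOmega_le_card {σ : Fin k → Fin D → E} (hσ : ∀ e, ∃ v j, σ v j = e) :
    graphOmega F σ ≤ Fintype.card E :=
  csInf_le (graphExponents_bddBelow hσ) (card_mem_graphExponents σ)

/-- `0 ≤ ω(T(G))` for a graph with no empty edge. [cite: ChristandlVranaZuiddam2016, Prop. 1.1.18] -/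
theorem graphOmega_nonneg {σ : Fin k → Fin D → E} (hσ : ∀ e, ∃ v j, σ v j = e) :
    0 ≤ graphOmega F σ :=
  le_csInf (graphExponents_nonempty σ) fun _ hβ => nonneg_of_mem_graphExponents hσ hβ

/-- Any exponent strictly above `ω(T(G))` is admissible (no empty edge).
[cite: ChristandlVranaZuiddam2016, Prop. 1.1.18] -/
theorem mem_graphExponents_of_lt {σ : Fin k → Fin D → E} (hσ : ∀ e, ∃ v j, σ v j = e) {β : ℝ}
    (h : graphOmega F σ < β) : β ∈ graphExponents F σ := by
  obtain ⟨γ, hγ, hγβ⟩ := (csInf_lt_iff (graphExponents_bddBelow hσ)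
    (graphExponents_nonempty σ)).1 h
  exact mem_graphExponents_of_le hγ hγβ.le

/-- `ω(T(G)) ≤ β` for every admissible `β` (no empty edge). [cite: ChristandlVranaZuiddam2016, Prop. 1.1.18] -/
theorem graphOmega_le_of_mem {σ : Fin k → Fin D → E} (hσ : ∀ e, ∃ v j, σ v j = e) {β : ℝ}
    (hβ : β ∈ graphExponents F σ) : graphOmega F σ ≤ β :=
  csInf_le (graphExponents_bddBelow hσ) hβ

/-- `τ(T(G)) ≤ 1` for a graph with no empty edge and at least one edge.
[cite: ChristandlVranaZuiddam2016, §1.2 (table)] -/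
theorem graphTau_le_one {σ : Fin k → Fin D → E} (hσ : ∀ e, ∃ v j, σ v j = e)
    (hE : 0 < Fintype.card E) : graphTau F σ ≤ 1 := by
  unfold graphTau
  rw [div_le_one (by exact_mod_cast hE)]
  exact graphOmega_le_card hσ

/-- Relabelling the edges along a bijection does not change the admissible exponents.
[cite: ChristandlVranaZuiddam2016, Def. 1.1.1] -/
theorem graphExponents_relabel {E' : Type*} [Fintype E'] [DecidableEq E'] (π : E ≃ E')
    (σ : Fin k → Fin D → E) : graphExponents F (fun v j => π (σ v j)) = graphExponents F σ := by
  ext β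
  simp only [mem_graphExponents_iff, graphTensor_relabel]

/-- Relabelling the edges along a bijection does not change `ω(T(G))`. [cite: ChristandlVranaZuiddam2016, Def. 1.1.1] -/
theorem graphOmega_relabel {E' : Type*} [Fintype E'] [DecidableEq E'] (π : E ≃ E')
    (σ : Fin k → Fin D → E) : graphOmega F (fun v j => π (σ v j)) = graphOmega F σ := by
  unfold graphOmega
  rw [graphExponents_relabel]

/-- Relabelling the edges along a bijection does not change `τ(T(G))`. [cite: ChristandlVranaZuiddam2016, Def. 1.1.25] -/
theorem graphTau_relabel {E' : Type*} [Fintype E'] [DecidableEq E'] (π : E ≃ E')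
    (σ : Fin k → Fin D → E) : graphTau F (fun v j => π (σ v j)) = graphTau F σ := by
  unfold graphTau
  rw [graphOmega_relabel, Fintype.card_congr π]

end Exponent

/-! ## §3. The printed families: cliques `K_k`, cycles `C_k`, the tetrahedron `K_4`
(CVZ19 Ex. 1.1.2; BCKLOSW26 §3.2) -/

section Families

variable (F : Type*) [Field F]

/-- The edges of the complete graph `K_k` on `Fin k`: unordered pairs of distinct vertices.
[cite: ChristandlVranaZuiddam2016, Ex. 1.1.2] -/
abbrev CliqueEdge (k : ℕ) : Type := {e : Sym2 (Fin k) // ¬ e.IsDiag}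

/-- `K_k` has `binom(k,2)` edges. [cite: ChristandlVranaZuiddam2016, §1.2 (table)] -/
theorem card_cliqueEdge (k : ℕ) : Fintype.card (CliqueEdge k) = k.choose 2 := by
  rw [Sym2.card_subtype_not_diag, Fintype.card_fin]

/-- Incidence slots of the complete graph `K_{d+1}` on `Fin (d+1)`: vertex `v` reads in slot
`j : Fin d` the label of the edge `{v, v.succAbove j}` (its `d` neighbours in increasing order)
(CVZ19 Ex. 1.1.2: `T_n(K_k) ∈ (ℂ^{n^{k-1}})^{⊗k}`). [cite: ChristandlVranaZuiddam2016, Ex. 1.1.2] -/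
def cliqueSlots (d : ℕ) : Fin (d + 1) → Fin d → CliqueEdge (d + 1) :=
  fun v j => ⟨s(v, v.succAbove j), by
    rw [Sym2.mk_isDiag_iff]
    exact (Fin.succAbove_ne v j).symm⟩

/-- Every edge of `K_{d+1}` is read by one of its endpoints (no empty edge). [cite: ChristandlVranaZuiddam2016, Ex. 1.1.2] -/
theorem cliqueSlots_covering (d : ℕ) : ∀ e, ∃ v j, cliqueSlots d v j = e := by
  rintro ⟨e, he⟩
  induction e using Sym2.ind with
  | h a b =>
    have hab : b ≠ a := fun h => he (by rw [Sym2.mk_isDiag_iff]; exact h.symm)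
    obtain ⟨j, hj⟩ := Fin.exists_succAbove_eq hab
    exact ⟨a, j, Subtype.ext (by simp [cliqueSlots, hj])⟩

/-- Incidence slots of the cycle `C_k` on `Fin k` (`k ≥ 1`): edges `Fin k`, edge `e` joins `e` and
`e + 1`; vertex `v` reads edge `v` in slot `0` and edge `v - 1` in slot `1`
(CVZ19 Ex. 1.1.2: `T_n(C_5) = ∑ b_{i₁i₂} ⊗ b_{i₂i₃} ⊗ ⋯ ⊗ b_{i₅i₁}`; `T_n(C_3) = ⟨n,n,n⟩`, `T_n(C_k)`
= iterated matrix multiplication). [cite: ChristandlVranaZuiddam2016, Ex. 1.1.2] -/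
def cycleSlots (k : ℕ) [NeZero k] : Fin k → Fin 2 → Fin k :=
  fun v => ![v, v - 1]

/-- Every edge of `C_k` is read (by its left endpoint, in slot `0`). [cite: ChristandlVranaZuiddam2016, Ex. 1.1.2] -/
theorem cycleSlots_covering (k : ℕ) [NeZero k] : ∀ e, ∃ v j, cycleSlots k v j = e :=
  fun e => ⟨e, 0, by simp [cycleSlots]⟩

/-- Incidence slots of the tetrahedron `K_4` with edges `Fin 6` in the order `01, 02, 03, 12, 13, 23`
and, at each vertex, its three edges in increasing order of the other endpoint — the slot table of
the tree's `Summit.MatrixMultiplication.….TetrahedronTensor.vertexLabels`/`tetra`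
(CVZ19 Ex. 1.1.2, up to the order of edges). [cite: ChristandlVranaZuiddam2016, Ex. 1.1.2] -/
def tetraSlots : Fin 4 → Fin 3 → Fin 6 :=
  ![![0, 1, 2], ![0, 3, 4], ![1, 3, 5], ![2, 4, 5]]

/-- Every edge of the tetrahedron is read. [cite: ChristandlVranaZuiddam2016, Ex. 1.1.2] -/
theorem tetraSlots_covering : ∀ e, ∃ v j, tetraSlots v j = e := by
  decide

/-- The edge names of `tetraSlots` inside `CliqueEdge 4`: `0 ↦ {0,1}, 1 ↦ {0,2}, 2 ↦ {0,3},
3 ↦ {1,2}, 4 ↦ {1,3}, 5 ↦ {2,3}`. [cite: ChristandlVranaZuiddam2016, Ex. 1.1.2] -/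
def tetraEdge : Fin 6 → CliqueEdge 4 :=
  ![⟨s(0, 1), by decide⟩, ⟨s(0, 2), by decide⟩, ⟨s(0, 3), by decide⟩,
    ⟨s(1, 2), by decide⟩, ⟨s(1, 3), by decide⟩, ⟨s(2, 3), by decide⟩]

/-- `tetraEdge` is injective. [cite: ChristandlVranaZuiddam2016, Ex. 1.1.2] -/
theorem tetraEdge_injective : Function.Injective tetraEdge := by
  intro a b h
  have h' := congrArg Subtype.val h
  fin_cases a <;> fin_cases b <;> first | rfl | (exfalso; revert h'; decide)

/-- `tetraEdge` is a bijection `Fin 6 ≃ E(K_4)`. [cite: ChristandlVranaZuiddam2016, Ex. 1.1.2] -/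
theorem tetraEdge_bijective : Function.Bijective tetraEdge := by
  rw [Fintype.bijective_iff_injective_and_card]
  exact ⟨tetraEdge_injective, by rw [card_cliqueEdge]; decide⟩

/-- The slot tables agree: `cliqueSlots 3 v j = tetraEdge (tetraSlots v j)`. [cite: ChristandlVranaZuiddam2016, Ex. 1.1.2] -/
theorem cliqueSlots_three_eq (v : Fin 4) (j : Fin 3) :
    cliqueSlots 3 v j = tetraEdge (tetraSlots v j) := by
  apply Subtype.ext
  fin_cases v <;> fin_cases j <;> decide

/-- **`K_4` two ways.** The clique presentation `cliqueSlots 3` gives literally the tetrahedron tensor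
of `tetraSlots` (edge relabelling `tetraEdge`). [cite: ChristandlVranaZuiddam2016, Ex. 1.1.2] -/
theorem graphTensor_cliqueSlots_three (n : ℕ) :
    graphTensor F (cliqueSlots 3) n = graphTensor F tetraSlots n := by
  have h : cliqueSlots 3 = fun v j => (Equiv.ofBijective tetraEdge tetraEdge_bijective) (tetraSlots v j) := by
    funext v j
    exact cliqueSlots_three_eq v j
  rw [h, graphTensor_relabel]

/-- `ω(T(K_4))` computed from either presentation. [cite: ChristandlVranaZuiddam2016, Ex. 1.1.2] -/
theorem graphOmega_cliqueSlots_three : graphOmega F (cliqueSlots 3) = graphOmega F tetraSlots := by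
  have h : cliqueSlots 3 = fun v j => (Equiv.ofBijective tetraEdge tetraEdge_bijective) (tetraSlots v j) := by
    funext v j
    exact cliqueSlots_three_eq v j
  rw [h, graphOmega_relabel]

/-- `τ(T(K_4)) = ω(T(K_4))/6` from either presentation. [cite: ChristandlVranaZuiddam2016, Def. 1.1.25] -/
theorem graphTau_cliqueSlots_three : graphTau F (cliqueSlots 3) = graphOmega F tetraSlots / 6 := by
  unfold graphTau
  rw [graphOmega_cliqueSlots_three, card_cliqueEdge]
  norm_num [Nat.choose]

/-- `ω(T(K_{d+1})) ≤ binom(d+1, 2)` (trivial cover). [cite: ChristandlVranaZuiddam2016, §1.2 (table)] -/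
theorem graphOmega_cliqueSlots_le (d : ℕ) :
    graphOmega F (cliqueSlots d) ≤ ((d + 1).choose 2 : ℕ) := by
  have h := graphOmega_le_card (F := F) (cliqueSlots_covering d)
  rwa [card_cliqueEdge] at h

/-- `ω(T(K_4)) ≤ 6`. [cite: ChristandlVranaZuiddam2016, §1.2 (table)] -/
theorem graphOmega_tetraSlots_le_six : graphOmega F tetraSlots ≤ 6 := by
  have h := graphOmega_le_card (F := F) tetraSlots_covering
  simpa using h

/-- `ω(T(C_k)) ≤ k` (trivial cover). [cite: ChristandlVranaZuiddam2016, Thm. 1.1.24] -/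
theorem graphOmega_cycleSlots_le (k : ℕ) [NeZero k] : graphOmega F (cycleSlots k) ≤ k := by
  have h := graphOmega_le_card (F := F) (cycleSlots_covering k)
  simpa using h

end Families

/-! ## §4. Named facts (as printed, at `F = ℂ`) -/

section Facts

/-- **CVZ19 Thm. 1.1.24 (Christandl–Zuiddam), first two clauses.** For `k ≥ 1` (`[NeZero k]`):
`ω(T(C_k)) = k` when `k` is even; `k − 1 ≤ ω(T(C_k)) ≤ (k−1)/2 · ω` when `k` is odd (`ω` = the
exponent of matrix multiplication, the tree's `omega ℂ`). The third clause (in terms of the dual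
exponent `α`) is not vendored. [cite: ChristandlVranaZuiddam2016, Thm. 1.1.24] -/
def cvz19_thm_1_1_24 : Prop :=
  ∀ (k : ℕ) [NeZero k],
    (Even k → graphOmega ℂ (cycleSlots k) = k) ∧
    (Odd k → ((k : ℝ) - 1 ≤ graphOmega ℂ (cycleSlots k) ∧
      graphOmega ℂ (cycleSlots k) ≤ ((k : ℝ) - 1) / 2 * omega ℂ))

/-- **CVZ19 Prop. 1.1.26 (clique covers).** "Let `k ≥ ℓ ≥ 2` be integers. Then
`τ(T(K_k)) ≤ τ(T(K_ℓ))`" — here `K_{d+1}` is `cliqueSlots d`, so `k = d₁ + 1 ≥ ℓ = d₂ + 1 ≥ 2`.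
[cite: ChristandlVranaZuiddam2016, Prop. 1.1.26] -/
def cvz19_prop_1_1_26 : Prop :=
  ∀ d₁ d₂ : ℕ, 1 ≤ d₂ → d₂ ≤ d₁ → graphTau ℂ (cliqueSlots d₁) ≤ graphTau ℂ (cliqueSlots d₂)

/-- **CVZ19 Cor. 1.2.6.** "For `k ≥ 4`, `τ(T(K_k)) ≤ min_{q≥2} log_q((q+2)/2) = log_7(9/2)` which is
approximately `0.772943`" (`K_k` = `cliqueSlots d`, `k = d + 1 ≥ 4`).
[cite: ChristandlVranaZuiddam2016, Cor. 1.2.6] -/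
def cvz19_cor_1_2_6 : Prop :=
  ∀ d : ℕ, 3 ≤ d → graphTau ℂ (cliqueSlots d) ≤ Real.logb 7 (9 / 2)

/-- **Brand–Curticapean–Kaski–Li–Orzel–Seppelt–Wang 2026, Thm. 48.** "For the `4`-clique, we have
`τ(K_4) < 0.772318`" (their `τ(G) = ω(G)/|E(G)|`, `ω(G) = inf{β | R(T_{G,n}) = O(n^β)}`, §3.2 —
the same quantity as `graphTau`).  Stated at `F = ℂ`. [cite: BrandEtAl2026, Thm. 48] -/
def brandEtAl2026_thm_48 : Prop :=
  graphTau ℂ (cliqueSlots 3) < 0.772318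
-- TODO(general form): BCKLOSW26 fixes "a field `F`" (§2.1); vendored at `F = ℂ`, where the
-- Coppersmith–Winograd analysis of App. C (following CVZ19, who work over `ℂ`) is carried out.

/-- Cor. 1.2.6 at `k = 4` in terms of `ω(T(K_4))` (either presentation): `ω(T(K_4)) ≤ 6 log_7(9/2)`
(`≈ 4.63766`, CVZ19 §1.2 table). [cite: ChristandlVranaZuiddam2016, Cor. 1.2.6] -/
theorem cvz19_cor_1_2_6.graphOmega_tetraSlots_le (h : cvz19_cor_1_2_6) :
    graphOmega ℂ tetraSlots ≤ 6 * Real.logb 7 (9 / 2) := by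
  have h4 := h 3 le_rfl
  rw [graphTau_cliqueSlots_three] at h4
  linarith

/-- Thm. 48 in terms of `ω(T(K_4))`: `ω(T(K_4)) < 6 · 0.772318 = 4.633908`. [cite: BrandEtAl2026, Thm. 48] -/
theorem brandEtAl2026_thm_48.graphOmega_tetraSlots_lt (h : brandEtAl2026_thm_48) :
    graphOmega ℂ tetraSlots < 4.633908 := by
  have h4 : graphTau ℂ (cliqueSlots 3) < 0.772318 := h
  rw [graphTau_cliqueSlots_three] at h4
  linarith

end Facts

end Literature.Computability.AlgebraicComplexity

end
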